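import Summits.ResolutionOfSingularities.ResolutionOfSingularities.Theorems.PurelyInseparableDim4HasseEulerLadder
import Literature.Barriers.ResolutionOfSingularities.ResidualOrderUnboundedNarrow
import Mathlib.Algebra.CharP.Lemmas
import HarnessLib

/-!
# Π, brick T4 (algebra): translation keeps `q`-th powers; the top layer of `E · G̃` (cell `res-dim4-pi`, I-5-5)

[OURS · counted 0 · instrument lemma]  Nothing here is a statement about resolution of singularities in
dimension ≥ 4 / characteristic `p`, which is NOT proved.  The one new algebra lemma of §3 «Proposition off R»
of res-dim4-idea-5's consolidated write-up `PiPlateau-consolidated.md` (ecef900b4de1a97c; blueprint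
d8a3f498d0e42ada §E ‹translate_isPthPower›) and the «homogeneous `G̃`» argument of the case `i = j` off R:

* `isPthPowerExponent_support_translate` — in characteristic `p`, `q = p^e`: if every monomial of `P` is a
  `q`-th power monomial then so is every monomial of `P(x + t)` (`(X + c)^{q n} = (X^q + c^q)^n`,
  Mathlib `add_pow_char_pow`);
* `coeff_mul_eq_of_forall_le_degree` — if all monomials of `W` have degree `≥ n` then in degree `≤ n` the product
  `E · W` is `E(0) · W`;
* **`isPthPowerExponent_and_dvd_of_layer`** — for `G = translate t (x^r · Q)` (`t ≠ 0` on `supp r`, all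
  monomials of `Q` of degree `≤ κ`): if every monomial of `G` has degree `≥ κ` and those of degree `≤ κ` are
  `q`-th powers, then every monomial of `Q` is a `q`-th power and `q ∣ κ`.  (Then `G̃ = translate t Q` is
  homogeneous of degree `κ`, the degree-`κ` layer of `G` is `E(0)·G̃`, so `G̃ ∈ K[x^q]`, so
  `Q = G̃(x − t) ∈ K[x^q]`.)

Typed and proved by res-dim4-typ-1.  Supports stmt-ResolutionOfSingularities-16155 (helper).
bears_on: LADDER-RESOLUTION:D157-DOOR2 (res-dim4-pi · I-5-5 Π · T4 algebra).
-/

set_option linter.dupNamespace false -- mandated namespace of this single-conjunct summit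

namespace Summit.ResolutionOfSingularities.ResolutionOfSingularities.Theorems.PIDim4

namespace Plateau

open MvPolynomial Finset
open scoped Pointwise
open Literature.AlgebraicGeometry.Resolution
open Literature.AlgebraicGeometry.Resolution.Hauser2010
open Literature.Barriers.ResolutionOfSingularities

variable {σ : Type*} [Fintype σ] [DecidableEq σ] {K : Type*} [Field K]

/-! ## §1 Polynomials all of whose monomials are `q`-th powers -/

omit [Fintype σ] [DecidableEq σ] in
/-- The zero exponent is a `q`-th power exponent. [folklore] -/
theorem isPthPowerExponent_zero (q : ℕ) : IsPthPowerExponent q (0 : σ →₀ ℕ) :=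
  fun i hi => absurd hi (by simp)

omit [Fintype σ] [DecidableEq σ] in
/-- Sums of `q`-th power exponents. [folklore] -/
theorem isPthPowerExponent_add (q : ℕ) {d d' : σ →₀ ℕ} (hd : IsPthPowerExponent q d)
    (hd' : IsPthPowerExponent q d') : IsPthPowerExponent q (d + d') := by
  rw [isPthPowerExponent_iff] at hd hd' ⊢
  intro i
  rw [Finsupp.coe_add, Pi.add_apply]
  exact dvd_add (hd i) (hd' i)

omit [DecidableEq σ] in
/-- A `q`-th power exponent has degree divisible by `q`. [folklore] -/
theorem dvd_degree_of_isPthPowerExponent (q : ℕ) {d : σ →₀ ℕ} (hd : IsPthPowerExponent q d) : q ∣ d.degree := by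
  rw [Finsupp.degree_eq_sum]
  exact Finset.dvd_sum fun i _ => (isPthPowerExponent_iff q d).mp hd i

omit [Fintype σ] in
/-- Constants. [folklore] -/
theorem isPthPowerExponent_support_C (q : ℕ) (c : K) :
    ∀ d ∈ (C c : MvPolynomial σ K).support, IsPthPowerExponent q d := by
  intro d hd
  rw [MvPolynomial.mem_support_iff, coeff_C] at hd
  split_ifs at hd with h
  · rw [← h]; exact isPthPowerExponent_zero q
  · exact absurd rfl hd

omit [Fintype σ] in
/-- Sums. [folklore] -/
theorem isPthPowerExponent_support_add (q : ℕ) {P Q : MvPolynomial σ K}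
    (hP : ∀ d ∈ P.support, IsPthPowerExponent q d) (hQ : ∀ d ∈ Q.support, IsPthPowerExponent q d) :
    ∀ d ∈ (P + Q).support, IsPthPowerExponent q d := by
  intro d hd
  rcases Finset.mem_union.mp (MvPolynomial.support_add hd) with h | h
  · exact hP d h
  · exact hQ d h

omit [Fintype σ] in
/-- Products. [folklore] -/
theorem isPthPowerExponent_support_mul (q : ℕ) {P Q : MvPolynomial σ K}
    (hP : ∀ d ∈ P.support, IsPthPowerExponent q d) (hQ : ∀ d ∈ Q.support, IsPthPowerExponent q d) :
    ∀ d ∈ (P * Q).support, IsPthPowerExponent q d := by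
  intro d hd
  obtain ⟨a, ha, b, hb, rfl⟩ := Finset.mem_add.mp (MvPolynomial.support_mul P Q hd)
  exact isPthPowerExponent_add q (hP a ha) (hQ b hb)

omit [Fintype σ] in
/-- Powers. [folklore] -/
theorem isPthPowerExponent_support_pow (q : ℕ) {P : MvPolynomial σ K}
    (hP : ∀ d ∈ P.support, IsPthPowerExponent q d) (n : ℕ) :
    ∀ d ∈ (P ^ n).support, IsPthPowerExponent q d := by
  induction n with
  | zero => rw [pow_zero, ← C_1]; exact isPthPowerExponent_support_C q 1
  | succ n ih => rw [pow_succ]; exact isPthPowerExponent_support_mul q ih hP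

omit [Fintype σ] in
/-- Finite products. [folklore] -/
theorem isPthPowerExponent_support_prod (q : ℕ) {ι : Type*} (s : Finset ι) (f : ι → MvPolynomial σ K)
    (hf : ∀ x ∈ s, ∀ d ∈ (f x).support, IsPthPowerExponent q d) :
    ∀ d ∈ (∏ x ∈ s, f x).support, IsPthPowerExponent q d := by
  refine Finset.prod_induction f (fun P => ∀ d ∈ P.support, IsPthPowerExponent q d)
    (fun a b ha hb => isPthPowerExponent_support_mul q ha hb) ?_ hf
  rw [← C_1]; exact isPthPowerExponent_support_C q 1

omit [Fintype σ] in
/-- Finite sums. [folklore] -/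
theorem isPthPowerExponent_support_sum (q : ℕ) {ι : Type*} (s : Finset ι) (f : ι → MvPolynomial σ K)
    (hf : ∀ x ∈ s, ∀ d ∈ (f x).support, IsPthPowerExponent q d) :
    ∀ d ∈ (∑ x ∈ s, f x).support, IsPthPowerExponent q d := by
  refine Finset.sum_induction f (fun P => ∀ d ∈ P.support, IsPthPowerExponent q d)
    (fun a b ha hb => isPthPowerExponent_support_add q ha hb) ?_ hf
  intro d hd; exact absurd hd (by simp)

omit [Fintype σ] in
/-- `X_m^q`. [folklore] -/
theorem isPthPowerExponent_support_X_pow (q : ℕ) (m : σ) :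
    ∀ d ∈ (X m ^ q : MvPolynomial σ K).support, IsPthPowerExponent q d := by
  intro d hd
  rw [X_pow_eq_monomial] at hd
  have := Finset.mem_singleton.mp (support_monomial_subset hd)
  rw [this, isPthPowerExponent_iff]
  intro i
  rw [Finsupp.single_apply]
  split_ifs
  · exact dvd_rfl
  · exact dvd_zero q

/-- **Translation keeps `q`-th powers** (`q = p^e`, characteristic `p`): if every monomial of `P` is a `q`-th
power monomial, so is every monomial of `P(x + t)` — since `(X + c)^{q n} = (X^q + c^q)^n`. [folklore] -/
theorem isPthPowerExponent_support_translate (p : ℕ) [Fact p.Prime] [CharP K p] (e : ℕ) (t : σ → K)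
    (P : MvPolynomial σ K) (hP : ∀ d ∈ P.support, IsPthPowerExponent (p ^ e) d) :
    ∀ d ∈ (PointBlowup.translate t P).support, IsPthPowerExponent (p ^ e) d := by
  rw [PointBlowup.translate_eq_sum_support]
  refine isPthPowerExponent_support_sum _ _ _ fun β hβ => ?_
  rw [PointBlowup.translate_monomial_eq_prod]
  refine isPthPowerExponent_support_mul _ (isPthPowerExponent_support_C _ _)
    (isPthPowerExponent_support_prod _ _ _ fun i _ => ?_)
  have hβi : p ^ e ∣ β i := (isPthPowerExponent_iff _ β).mp (hP β hβ) i
  rw [← Nat.mul_div_cancel' hβi, pow_mul, add_pow_char_pow (X i) (C (t i)) p e]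
  exact isPthPowerExponent_support_pow _
    (isPthPowerExponent_support_add _ (isPthPowerExponent_support_X_pow _ i)
      (isPthPowerExponent_support_pow _ (isPthPowerExponent_support_C _ (t i)) _)) _

/-! ## §2 The lowest layer of a product with a unit -/

/-- If all monomials of `W` have degree `≥ n`, then in degrees `≤ n` the product `E · W` is `E(0) · W`.
[folklore] -/
theorem coeff_mul_eq_of_forall_le_degree (E W : MvPolynomial σ K) {n : ℕ} (hW : ∀ b ∈ W.support, n ≤ b.degree)
    {k : σ →₀ ℕ} (hk : k.degree ≤ n) : coeff k (E * W) = coeff 0 E * coeff k W := by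
  rw [coeff_mul, Finset.sum_eq_single (0, k)]
  · intro x hx hne
    rw [Finset.mem_antidiagonal] at hx
    by_cases hx2 : x.2 ∈ W.support
    · exfalso
      apply hne
      have hle : x.2 ≤ k := by rw [← hx]; exact le_add_self
      rcases hle.lt_or_eq with hlt | heq
      · have := PointBlowup.degree_lt_degree_of_lt hlt
        have := hW _ hx2
        omega
      · have h1 : x.1 = 0 := by
          have := hx; rw [heq] at this; exact add_eq_right.mp this
        exact Prod.ext h1 heq
    · rw [MvPolynomial.notMem_support_iff.mp hx2, mul_zero]
  · intro h
    exact absurd (Finset.mem_antidiagonal.mpr (zero_add k)) h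

/-- The unit `(x + t)^r`, `t ≠ 0` on `supp r`, has non-zero constant term. [folklore] -/
theorem coeff_zero_translate_monomial_ne_zero (t : σ → K) (r : σ →₀ ℕ) (ht : ∀ m ∈ r.support, t m ≠ 0) :
    coeff 0 (PointBlowup.translate t (monomial r (1 : K))) ≠ 0 := by
  have h := HasseEuler.ordZero_translate_monomial_mul t r ht 1
  rw [mul_one, show ordZero (1 : MvPolynomial σ K) = 0 from (ordZero_eq_zero_iff _).mpr (by simp),
    ordZero_eq_zero_iff, constantCoeff_eq] at h
  exact h

/-! ## §3 The case `i = j` off regime R: `Q ∈ K[x^q]` and `q ∣ κ` -/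

/-- **Top layer ⇒ `q`-th powers.**  Let `G = translate t (x^r · Q)` with `t ≠ 0` on `supp r`, `Q ≠ 0`, all
monomials of `Q` of degree `≤ κ`.  If every monomial of `G` has degree `≥ κ`, and every monomial of `G` of degree
`≤ κ` is a `q`-th power (`q = p^e`), then every monomial of `Q` is a `q`-th power and `q ∣ κ`. [folklore] -/
theorem isPthPowerExponent_and_dvd_of_layer (p : ℕ) [Fact p.Prime] [CharP K p] (e : ℕ) (t : σ → K)
    (r : σ →₀ ℕ) (ht : ∀ m ∈ r.support, t m ≠ 0) (Q : MvPolynomial σ K) (hQ : Q ≠ 0) (κ : ℕ)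
    (hdeg : ∀ β ∈ Q.support, β.degree ≤ κ)
    (hord : ∀ k ∈ (PointBlowup.translate t (monomial r (1 : K) * Q)).support, κ ≤ k.degree)
    (hpth : ∀ k ∈ (PointBlowup.translate t (monomial r (1 : K) * Q)).support, k.degree ≤ κ →
      IsPthPowerExponent (p ^ e) k) :
    (∀ β ∈ Q.support, IsPthPowerExponent (p ^ e) β) ∧ p ^ e ∣ κ := by
  set E := PointBlowup.translate t (monomial r (1 : K)) with hE
  set G' := PointBlowup.translate t Q with hG'
  have hG : PointBlowup.translate t (monomial r (1 : K) * Q) = E * G' := MohAlong.translate_mul t _ Q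
  have h1 : ∀ k ∈ G'.support, k.degree ≤ κ :=
    fun k hk => HasseEuler.degree_le_of_mem_support_translate t Q hdeg hk
  have hordG : ((κ : ℕ) : ℕ∞) ≤ ordZero (E * G') :=
    (HauserPerlega.natCast_le_ordZero_iff (E * G') κ).mpr (by rw [← hG]; exact hord)
  have hordG' : ((κ : ℕ) : ℕ∞) ≤ ordZero G' := by
    rwa [hE, HasseEuler.ordZero_translate_monomial_mul t r ht] at hordG
  have h2 : ∀ k ∈ G'.support, κ ≤ k.degree := (HauserPerlega.natCast_le_ordZero_iff G' κ).mp hordG'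
  have hE0 : coeff 0 E ≠ 0 := coeff_zero_translate_monomial_ne_zero t r ht
  have h3 : ∀ k ∈ G'.support, IsPthPowerExponent (p ^ e) k := by
    intro k hk
    have hc : coeff k (E * G') = coeff 0 E * coeff k G' := coeff_mul_eq_of_forall_le_degree E G' h2 (h1 k hk)
    have hmem : k ∈ (PointBlowup.translate t (monomial r (1 : K) * Q)).support := by
      rw [hG, MvPolynomial.mem_support_iff, hc]
      exact mul_ne_zero hE0 (MvPolynomial.mem_support_iff.mp hk)
    exact hpth k hmem (h1 k hk)
  have hQpth : ∀ β ∈ Q.support, IsPthPowerExponent (p ^ e) β := by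
    have hQ' : Q = PointBlowup.translate (fun m => -t m) G' := (PointBlowup.translate_neg_translate t Q).symm
    rw [hQ']
    exact isPthPowerExponent_support_translate p e _ G' h3
  refine ⟨hQpth, ?_⟩
  have hG'0 : G' ≠ 0 := PointBlowup.translate_ne_zero t hQ
  obtain ⟨k, hk⟩ := MvPolynomial.support_nonempty.mpr hG'0
  obtain ⟨β, hβ, hle⟩ := PointBlowup.exists_le_of_mem_support_translate t Q hk
  have hβκ : β.degree = κ := le_antisymm (hdeg β hβ) ((h2 k hk).trans (Finsupp.degree_mono hle))
  rw [← hβκ]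
  exact dvd_degree_of_isPthPowerExponent _ (hQpth β hβ)

end Plateau

end Summit.ResolutionOfSingularities.ResolutionOfSingularities.Theorems.PIDim4
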